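import Summits.Parity.BatemanHorn.Theses.RoughValueTransport

/-!
# `BalancedSemiprimeLayer` (crux stmt-Parity-9469): the hypotheses that are NOT load-bearing

Negative-side hypothesis analysis (cdisprove, refuter-cdisprove-stmt-Parity-9469-g2-0), all PROVED —
the complement of the three `FalseWithout*.lean` refutations:

* `balancedSemiprimeLayer_iff_withoutLeadingCoeffPos` — the crux is EQUIVALENT to its variant with
  `leadingCoeff_pos` dropped: a coordinate with negative leading coefficient is positive at only
  finitely many `n` (`exists_eval_nonpos_of_leadingCoeff_neg`), so the count is `O(1)` while the
  tolerance `ε·x/(log x)^k → ∞` (`tendsto_mul_div_log_pow_atTop`);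
* `balancedSemiprimeLayer_imp_of_natDegree_pos` — `hasNoFixedPrimeDivisor` matters ONLY to exclude
  prime constants: the crux implies its own variant for NON-CONSTANT systems that may have a fixed
  prime divisor, because such a divisor `p` divides some `fᵢ(n)` for every `n`
  (`exists_dvd_eval_of_le_polyRootCountMod`) and lies below every sifting range
  `x^{deg fᵢ(1−δ)/2} ≥ x^{3/8}` eventually, so the count is `0` eventually
  (`card_cruxFilter_eq_zero_of_fixed_prime`).
-/

namespace Summit.Parity.BatemanHorn.Theorems.BalancedSemiprimeLayer.Negative

open Filter Finset Polynomial Real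
open scoped Topology
open Literature.NumberTheory.Sieve
open Summit.Parity.BatemanHorn.Theses.RoughValueTransport (BalancedSemiprimeLayer)

/-! ### `leadingCoeff_pos` is decoration -/

/-- `ε · x/(log x)^k → ∞` along `ℕ` for `ε > 0`. [folklore] -/
theorem tendsto_mul_div_log_pow_atTop {ε : ℝ} (hε : 0 < ε) (k : ℕ) :
    Tendsto (fun x : ℕ => ε * x / Real.log x ^ k) atTop atTop := by
  have h1 : Tendsto (fun x : ℝ => Real.log x ^ k / x) atTop (𝓝 0) := by
    simpa using Real.tendsto_pow_log_div_mul_add_atTop 1 0 k one_ne_zero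
  have h2 : Tendsto (fun x : ℝ => Real.log x ^ k / x) atTop (𝓝[>] 0) := by
    refine tendsto_nhdsWithin_iff.mpr ⟨h1, ?_⟩
    filter_upwards [eventually_gt_atTop 1] with x hx
    exact div_pos (pow_pos (Real.log_pos hx) k) (by linarith)
  have h3 := (h2.inv_tendsto_nhdsGT_zero).comp tendsto_natCast_atTop_atTop
  have h4 := h3.const_mul_atTop hε
  refine h4.congr' (Eventually.of_forall fun x => ?_)
  simp only [Function.comp_apply, Pi.inv_apply, inv_div]
  ring

/-- A polynomial with negative leading coefficient is eventually `≤ 0` along `ℕ`. [folklore] -/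
theorem exists_eval_nonpos_of_leadingCoeff_neg {P : ℤ[X]} (h : P.leadingCoeff < 0) :
    ∃ M : ℕ, ∀ n : ℕ, M ≤ n → P.eval (n : ℤ) ≤ 0 := by
  rcases Nat.eq_zero_or_pos P.natDegree with hdeg | hdeg
  · refine ⟨0, fun n _ => ?_⟩
    rw [eq_C_of_natDegree_eq_zero hdeg, eval_C]
    rw [leadingCoeff, hdeg] at h
    exact h.le
  · set Q : ℝ[X] := P.map (Int.castRingHom ℝ) with hQ
    have hinj : Function.Injective (Int.castRingHom ℝ) := Int.cast_injective
    have hQdeg : 0 < Q.degree := by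
      rw [hQ, degree_map_eq_of_injective hinj]
      exact natDegree_pos_iff_degree_pos.mp hdeg
    have hQlc : Q.leadingCoeff ≤ 0 := by
      rw [hQ, leadingCoeff_map_of_injective hinj, eq_intCast]
      exact_mod_cast h.le
    have ht := (Q.tendsto_atBot_of_leadingCoeff_nonpos hQdeg hQlc).comp tendsto_natCast_atTop_atTop
    obtain ⟨M, hM⟩ := eventually_atTop.mp (ht.eventually (eventually_le_atBot 0))
    refine ⟨M, fun n hn => ?_⟩
    have h1 := hM n hn
    simp only [Function.comp_apply, hQ, eval_natCast_map, eq_intCast] at h1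
    exact_mod_cast h1

/-- **`leadingCoeff_pos` is NOT load-bearing**: the crux is equivalent to its variant without it.
[folklore] -/
theorem balancedSemiprimeLayer_iff_withoutLeadingCoeffPos :
    BalancedSemiprimeLayer ↔
      ∀ (k : ℕ) (f : Fin k → ℤ[X]), (∀ i, Irreducible (f i)) →
        (Pairwise fun i j => ¬Associated (f i) (f j)) → HasNoFixedPrimeDivisor f →
          ∀ ε : ℝ, 0 < ε → ∃ δ : ℝ, 0 < δ ∧ δ ≤ 1 / 4 ∧ ∀ᶠ x : ℕ in atTop,
            (((Icc 1 x).filter (fun n : ℕ => ∀ i, 0 < (f i).eval (n : ℤ) ∧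
              ∀ p ∈ range ⌈(x : ℝ) ^ (((f i).natDegree : ℝ) * (1 - δ) / 2)⌉₊,
                p.Prime → ¬ ((p : ℤ) ∣ (f i).eval (n : ℤ)))).card : ℝ) ≤
              (polyPrimeCount f x : ℝ) + ε * (x : ℝ) / Real.log x ^ k := by
  constructor
  · intro h k f hirr hpw hN
    by_cases hlc : ∀ i, 0 < (f i).leadingCoeff
    · exact h k f ⟨hirr, hlc, hpw, hN⟩
    · push Not at hlc
      obtain ⟨i, hi⟩ := hlc
      have hne : (f i).leadingCoeff ≠ 0 := leadingCoeff_ne_zero.mpr (hirr i).ne_zero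
      have hlt : (f i).leadingCoeff < 0 := lt_of_le_of_ne hi hne
      obtain ⟨M, hM⟩ := exists_eval_nonpos_of_leadingCoeff_neg hlt
      have hbound : ∀ (δ : ℝ) (x : ℕ),
          #((Icc 1 x).filter (fun n : ℕ => ∀ i, 0 < (f i).eval (n : ℤ) ∧
            ∀ p ∈ range ⌈(x : ℝ) ^ (((f i).natDegree : ℝ) * (1 - δ) / 2)⌉₊,
              p.Prime → ¬ ((p : ℤ) ∣ (f i).eval (n : ℤ)))) ≤ M := by
        intro δ x
        calc _ ≤ #(range M) := by
              refine card_le_card fun n hn => ?_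
              simp only [mem_filter] at hn
              rw [mem_range]
              by_contra hMn
              exact absurd (hM n (not_lt.mp hMn)) (not_le.mpr (hn.2 i).1)
          _ = M := card_range M
      intro ε hε
      refine ⟨1 / 4, by norm_num, le_rfl, ?_⟩
      filter_upwards [(tendsto_mul_div_log_pow_atTop hε k).eventually_ge_atTop (M : ℝ)] with x hx
      calc _ ≤ (M : ℝ) := by exact_mod_cast hbound _ x
        _ ≤ ε * x / Real.log x ^ k := hx
        _ ≤ (polyPrimeCount f x : ℝ) + ε * x / Real.log x ^ k :=
            le_add_of_nonneg_left (Nat.cast_nonneg _)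
  · intro h k f hf
    exact h k f hf.irreducible hf.pairwise_not_associated hf.hasNoFixedPrimeDivisor

/-! ### `hasNoFixedPrimeDivisor` matters only through prime constants -/

/-- A prime `p` with `ω_f(p) = p` divides some `fᵢ(n)` for EVERY `n`. [folklore] -/
theorem exists_dvd_eval_of_le_polyRootCountMod {k : ℕ} {f : Fin k → ℤ[X]} {p : ℕ} (hp : p.Prime)
    (h : ¬ polyRootCountMod f p < p) (n : ℕ) : ∃ i, (p : ℤ) ∣ (f i).eval (n : ℤ) := by
  have heq : polyRootCountMod f p = p := le_antisymm (polyRootCountMod_le f p) (not_lt.mp h)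
  have hall : ∀ m ∈ range p, (p : ℤ) ∣ ∏ i, (f i).eval (m : ℤ) := by
    refine Finset.card_filter_eq_iff.mp ?_
    rw [card_range]
    exact heq
  have hm : (p : ℤ) ∣ ∏ i, (f i).eval ((n % p : ℕ) : ℤ) :=
    hall (n % p) (mem_range.mpr (Nat.mod_lt n hp.pos))
  obtain ⟨i, -, hi⟩ := ((Nat.prime_iff_prime_int.mp hp).dvd_finsetProd_iff _).mp hm
  refine ⟨i, ?_⟩
  have hsub : (p : ℤ) ∣ (n : ℤ) - ((n % p : ℕ) : ℤ) := by
    have hdiv := Nat.mod_add_div n p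
    refine ⟨((n / p : ℕ) : ℤ), ?_⟩
    have : ((n : ℕ) : ℤ) = ((n % p : ℕ) : ℤ) + (p : ℤ) * ((n / p : ℕ) : ℤ) := by
      exact_mod_cast hdiv.symm
    linarith
  have h3 : (p : ℤ) ∣ (f i).eval (n : ℤ) - (f i).eval ((n % p : ℕ) : ℤ) :=
    hsub.trans (sub_dvd_eval_sub (n : ℤ) ((n % p : ℕ) : ℤ) (f i))
  have h4 := dvd_add h3 hi
  rwa [sub_add_cancel] at h4

/-- A fixed prime divisor below every sifting range empties the crux count. [folklore] -/
theorem card_cruxFilter_eq_zero_of_fixed_prime {k : ℕ} {f : Fin k → ℤ[X]} {p : ℕ} (hp : p.Prime)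
    (hfix : ∀ n : ℕ, ∃ i, (p : ℤ) ∣ (f i).eval (n : ℤ)) {δ : ℝ} {x : ℕ}
    (hx : ∀ i, (p : ℝ) < (x : ℝ) ^ (((f i).natDegree : ℝ) * (1 - δ) / 2)) :
    #((Icc 1 x).filter (fun n : ℕ => ∀ i, 0 < (f i).eval (n : ℤ) ∧
      ∀ p ∈ range ⌈(x : ℝ) ^ (((f i).natDegree : ℝ) * (1 - δ) / 2)⌉₊,
        p.Prime → ¬ ((p : ℤ) ∣ (f i).eval (n : ℤ)))) = 0 := by
  rw [Finset.card_eq_zero, Finset.eq_empty_iff_forall_notMem]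
  intro n hn
  simp only [mem_filter] at hn
  obtain ⟨i, hi⟩ := hfix n
  exact (hn.2 i).2 p (mem_range.mpr (Nat.lt_ceil.mpr (hx i))) hp hi

/-- For non-constant coordinates the sifting ranges pass any fixed `p` eventually. [folklore] -/
theorem eventually_lt_rpow_cruxExponent {k : ℕ} (f : Fin k → ℤ[X]) (hdeg : ∀ i, 0 < (f i).natDegree)
    {δ : ℝ} (hδ : δ ≤ 1 / 4) (p : ℕ) :
    ∀ᶠ x : ℕ in atTop, ∀ i, (p : ℝ) < (x : ℝ) ^ (((f i).natDegree : ℝ) * (1 - δ) / 2) := by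
  have h : Tendsto (fun x : ℕ => (x : ℝ) ^ ((3 : ℝ) / 8)) atTop atTop :=
    (tendsto_rpow_atTop (by norm_num)).comp tendsto_natCast_atTop_atTop
  filter_upwards [h.eventually_gt_atTop (p : ℝ), eventually_ge_atTop 1] with x hx hx1 i
  refine lt_of_lt_of_le hx (Real.rpow_le_rpow_of_exponent_le (by exact_mod_cast hx1) ?_)
  have hd : (1 : ℝ) ≤ (f i).natDegree := by exact_mod_cast hdeg i
  nlinarith

/-- **`hasNoFixedPrimeDivisor` is NOT load-bearing for non-constant systems**: the crux implies its
variant for systems of irreducible, positive, pairwise non-associated polynomials of degree `≥ 1`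
that MAY have a fixed prime divisor. [folklore] -/
theorem balancedSemiprimeLayer_imp_of_natDegree_pos (hcrux : BalancedSemiprimeLayer) {k : ℕ}
    (f : Fin k → ℤ[X]) (hirr : ∀ i, Irreducible (f i)) (hlc : ∀ i, 0 < (f i).leadingCoeff)
    (hpw : Pairwise fun i j => ¬Associated (f i) (f j)) (hdeg : ∀ i, 0 < (f i).natDegree)
    (ε : ℝ) (hε : 0 < ε) :
    ∃ δ : ℝ, 0 < δ ∧ δ ≤ 1 / 4 ∧ ∀ᶠ x : ℕ in atTop,
      (((Icc 1 x).filter (fun n : ℕ => ∀ i, 0 < (f i).eval (n : ℤ) ∧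
        ∀ p ∈ range ⌈(x : ℝ) ^ (((f i).natDegree : ℝ) * (1 - δ) / 2)⌉₊,
          p.Prime → ¬ ((p : ℤ) ∣ (f i).eval (n : ℤ)))).card : ℝ) ≤
        (polyPrimeCount f x : ℝ) + ε * (x : ℝ) / Real.log x ^ k := by
  by_cases hN : HasNoFixedPrimeDivisor f
  · exact hcrux k f ⟨hirr, hlc, hpw, hN⟩ ε hε
  · unfold HasNoFixedPrimeDivisor at hN
    push Not at hN
    obtain ⟨p, hp, hpc⟩ := hN
    have hfix := fun n => exists_dvd_eval_of_le_polyRootCountMod (f := f) hp (not_lt.mpr hpc) n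
    refine ⟨1 / 4, by norm_num, le_rfl, ?_⟩
    filter_upwards [eventually_lt_rpow_cruxExponent f hdeg le_rfl p] with x hx
    rw [card_cruxFilter_eq_zero_of_fixed_prime hp hfix hx]
    push_cast
    positivity

end Summit.Parity.BatemanHorn.Theorems.BalancedSemiprimeLayer.Negative
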